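import Summits.CriticalPhenomena.PercolationContinuityZ3.Theorems.PercNearOneGluingNoHeavyQuantDECAtTMixtures
import Summits.CriticalPhenomena.PercolationContinuityZ3.Theorems.PercNearOneGluingNoHeavyQuantConvAtoms
import Summits.CriticalPhenomena.PercolationContinuityZ3.Theorems.PercNearOneGluingNoHeavyQuantPinnedConv
import HarnessLib

/-!
# QUANT lane R8, T-DEC, the q < 1 slice of `SingleGateConvClosed` for a GENERAL second factor: the PIECE DECOMPOSITION with ONE zero budget —
# `gate_q(μ₁ ∗ μ₂)` (μ₁ empty-free) is an exact mixture, over ANY decomposition `gate_q μ₁ = Σ λ_i C_i`, of the pieces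
# `C_i(0)·δ₀ + (C_i|_{≥1}) ∗ μ₂ + u_i·δ₀` with `Σ λ_i u_i = 0`; hence DEC of the (normalised) pieces at a common `(y, t, j)` gives DEC of `gate_q(μ₁ ∗ μ₂)`

builds on p205010 (kernel theorem, internal audit signed; external expert review pending)

Support file (`--supports stmt-CriticalPhenomena-4575`), QUANT lane lead seat prim-quant-lead (gen 28), rung R8 of `run/shared/lean/prim/quant/LADDER.md`.
Theorems only (no definitions), standard axioms, no sorries.  The general-second-factor analogue of arm-1 g38's `…QuantGateSlicePieces` (blob second factor,
`gateSlice_eq_pieces` / `gateSlice_decAtT_of_pieces`, two budgets); uses census-2 g53's `gate` / `lconv` (`…QuantSDEC`), `decAtT_finite_mixture`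
(`…QuantDECAtTMixtures`), `lconv_sum_left` (`…QuantConvAtoms`) and lead g24's `lconv_smul_left` / `pconv` file (`…QuantPinnedConv`: this file's pieces are the
full-pinning instance `pconv (gate μ₁ q) (1−q) μ₂` of lead g24's pinned convolution, `gate_lconv_eq_pconv`).  Memo FOR-PROVERS-SINGLE-GATE.md §5; LEAD-NOTES-G28 N86–N87.

WHY.  In pconv form the q < 1 slice of `LawDec.SingleGateConvClosed` (lead g28, `…QuantSingleGateClosure`) reads: `ν = gate_q μ₁` (μ₁ empty-free, so `ν 0 = 1 − q`)
DEC at all layers and `gate_q μ₂` DEC at all layers ⟹ `gate_q(μ₁ ∗ μ₂) = ν(0)·δ₀ + Σ_{h ≥ 1} ν(h)·μ₂(· − h)` DEC at all layers.  Over a DEC datum `ν = Σ λ_i C_i` the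
law splits into PIECES: zero-components `{0, h; γ}` ↦ `(1−γ)δ₀ + γ·μ₂(·−h)` (`μ₂` hung `h` deep under the gate `γ`), pairs `{l, h; γ′}` (`l ≥ 1`) ↦ `C ∗ μ₂`, points
`k` ↦ `μ₂(·−k)`; the zero atom may be redistributed among the pieces (`u_i`, `Σ λ_i u_i = 0`).  Exact census (lead g28 exp14, boundary-pushed, multi-low instances):
with `zcap_i` = the largest zero mass the zero-free core of piece `i` carries while DEC, the ONE-BUDGET certificate `Σ λ_i zcap_i ≥ ν(0)` holds in 846 / 846
instances with live cores (blob / two-point / general second factor), the residue being (a) dead cores from light straddlers of a one-layer datum (cured by a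
window datum) and (b) a thin cross-row coupling through `μ₂` (1 / 1 100; N87 correction).  This file is the bookkeeping that turns per-piece DEC + one budget into
DEC of the gated convolution; the per-piece cells and the budget lemma are the open content.

* (uses census-2 g56's `LawDec.lconv_sum_left` and lead g24's `LawDec.lconv_smul_left`; `LawDec.lconv_restrict_pos` here.)
* `LawDec.gateConv_eq_pieces` — the identity: `μ₁ 0 = 0`, `gate μ₁ q = Σ λ_i C_i` pointwise, `Σ λ_i u_i = 0` ⟹
  `gate (lconv M₁ M₂ μ₁ μ₂) q h = Σ_i λ_i·(C_i 0·[h = 0] + lconv M₁ M₂ (C_i|_{≥1}) μ₂ h + u_i·[h = 0])`, where `C|_{≥1} k = if k = 0 then 0 else C k`.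
* **`LawDec.gateConv_decAtT_of_pieces`** — with normalisers `s_i > 0`, `Σ λ_i s_i = 1`: DEC of every charged normalised piece at `(y, t, j)` ⟹
  `DECAtT y t j M′ (gate (lconv M₁ M₂ μ₁ μ₂) q)` (`decAtT_finite_mixture`).

[this work]; nothing here is cited as a published result.  The gluing rows served [cite: KozmaNitzan2024, Conjecture 3 (p. 15)]; product measure
[cite: Grimmett1999, §1.3 p. 10].
-/

noncomputable section

namespace Summit.CriticalPhenomena.PercolationContinuityZ3.Theorems

namespace Quant

open Finset

namespace LawDec

/-- the convolution does not see the zero atom of an empty-free first factor: `lconv μ₁ μ₂ = lconv (μ₁|_{≥1}) μ₂` when `μ₁ 0 = 0`. [this work] -/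
theorem lconv_restrict_pos (M₁ M₂ : ℕ) (μ₁ μ₂ : ℕ → ℝ) (h0 : μ₁ 0 = 0) (h : ℕ) :
    lconv M₁ M₂ μ₁ μ₂ h = lconv M₁ M₂ (fun k => if k = 0 then 0 else μ₁ k) μ₂ h := by
  simp only [lconv]
  refine Finset.sum_congr rfl fun a _ => Finset.sum_congr rfl fun b _ => ?_
  by_cases ha : a = 0
  · subst ha; simp [h0]
  · rw [if_neg ha]

/-- **THE PIECE IDENTITY (general second factor, one zero budget).**  Let `μ₁` be empty-free (`μ₁ 0 = 0`) and `gate μ₁ q = Σ_i λ_i C_i`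
pointwise (any finite decomposition of the gated first factor; any real `q`); let `u` be a zero budget with `Σ_i λ_i u_i = 0`.  Then for every `h`
`gate (lconv M₁ M₂ μ₁ μ₂) q h = Σ_i λ_i·(C_i 0·[h = 0] + lconv M₁ M₂ (C_i|_{≥1}) μ₂ h + u_i·[h = 0])`. [this work] -/
theorem gateConv_eq_pieces {ι : Type} [Fintype ι] (M₁ M₂ : ℕ) (μ₁ μ₂ : ℕ → ℝ) (q : ℝ) (lam u : ι → ℝ) (C : ι → ℕ → ℝ)
    (h0 : μ₁ 0 = 0) (hν : ∀ h, gate μ₁ q h = ∑ i, lam i * C i h) (hu : ∑ i, lam i * u i = 0) (h : ℕ) :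
    gate (lconv M₁ M₂ μ₁ μ₂) q h =
      ∑ i, lam i * (C i 0 * (if h = 0 then (1:ℝ) else 0) + lconv M₁ M₂ (fun k => if k = 0 then 0 else C i k) μ₂ h
        + u i * (if h = 0 then (1:ℝ) else 0)) := by
  -- the zero atom of the gated first factor is `1 − q = Σ λ_i C_i 0`
  have hz : ∑ i, lam i * C i 0 = 1 - q := by
    rw [← hν 0]; simp [gate, h0]
  -- the positive part: `q·μ₁ k = Σ λ_i C_i k` for `k ≥ 1`, hence `q·(μ₁|_{≥1}) = Σ λ_i (C_i|_{≥1})`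
  have hpos : ∀ k, (fun k => q * (if k = 0 then 0 else μ₁ k)) k = ∑ i, lam i * (fun k => if k = 0 then (0:ℝ) else C i k) k := by
    intro k
    by_cases hk : k = 0
    · subst hk; simp
    · simp only [if_neg hk]
      have := hν k
      simp only [gate, if_neg hk, add_zero] at this
      exact this
  -- assemble
  have hfun : (fun k => q * (if k = 0 then (0:ℝ) else μ₁ k)) = (fun k => ∑ i, lam i * (if k = 0 then (0:ℝ) else C i k)) := by
    funext k; have := hpos k; simpa using this
  have hconv : q * lconv M₁ M₂ μ₁ μ₂ h = ∑ i, lam i * lconv M₁ M₂ (fun k => if k = 0 then 0 else C i k) μ₂ h := by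
    rw [lconv_restrict_pos M₁ M₂ μ₁ μ₂ h0 h, ← lconv_smul_left, hfun]
    exact lconv_sum_left M₁ M₂ μ₂ lam (fun i k => if k = 0 then (0:ℝ) else C i k) h
  simp only [gate]
  rw [hconv]
  have e : ∀ i, lam i * (C i 0 * (if h = 0 then (1:ℝ) else 0) + lconv M₁ M₂ (fun k => if k = 0 then 0 else C i k) μ₂ h
      + u i * (if h = 0 then (1:ℝ) else 0))
      = lam i * lconv M₁ M₂ (fun k => if k = 0 then 0 else C i k) μ₂ h
        + (if h = 0 then (1:ℝ) else 0) * (lam i * C i 0) + (if h = 0 then (1:ℝ) else 0) * (lam i * u i) := fun i => by ring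
  rw [Finset.sum_congr rfl (fun i _ => e i), Finset.sum_add_distrib, Finset.sum_add_distrib, ← Finset.mul_sum, ← Finset.mul_sum, hz, hu,
    mul_zero, add_zero]
  split_ifs <;> ring

/-- **REASSEMBLY (general second factor).**  With the data of `gateConv_eq_pieces`, weights `λ ≥ 0`, normalisers `s_i > 0` with `Σ λ_i s_i = 1`: if every
charged normalised piece `(C_i 0·δ₀ + (C_i|_{≥1}) ∗ μ₂ + u_i·δ₀)/s_i` is `DECAtT y t j M′`, then so is `gate (lconv M₁ M₂ μ₁ μ₂) q`
(`decAtT_finite_mixture`). [this work] -/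
theorem gateConv_decAtT_of_pieces {ι : Type} [Fintype ι] (y t : ℝ) (j M' M₁ M₂ : ℕ) (μ₁ μ₂ : ℕ → ℝ) (q : ℝ) (lam u s : ι → ℝ)
    (C : ι → ℕ → ℝ) (h0 : μ₁ 0 = 0) (hν : ∀ h, gate μ₁ q h = ∑ i, lam i * C i h) (hu : ∑ i, lam i * u i = 0)
    (hlam : ∀ i, 0 ≤ lam i) (hs : ∀ i, 0 < s i) (hmass : ∑ i, lam i * s i = 1)
    (hdec : ∀ i, 0 < lam i → DECAtT y t j M'
      (fun h => (C i 0 * (if h = 0 then (1:ℝ) else 0) + lconv M₁ M₂ (fun k => if k = 0 then 0 else C i k) μ₂ h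
        + u i * (if h = 0 then (1:ℝ) else 0)) / s i)) :
    DECAtT y t j M' (gate (lconv M₁ M₂ μ₁ μ₂) q) := by
  refine decAtT_finite_mixture y t j M' (gate (lconv M₁ M₂ μ₁ μ₂) q) (fun i => lam i * s i)
    (fun i h => (C i 0 * (if h = 0 then (1:ℝ) else 0) + lconv M₁ M₂ (fun k => if k = 0 then 0 else C i k) μ₂ h
        + u i * (if h = 0 then (1:ℝ) else 0)) / s i)
    (fun i => mul_nonneg (hlam i) (hs i).le) hmass (fun h => ?_)
    (fun i hi => hdec i (lt_of_le_of_ne (hlam i) (fun h0' => by rw [← h0', zero_mul] at hi; exact lt_irrefl _ hi)))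
  rw [gateConv_eq_pieces M₁ M₂ μ₁ μ₂ q lam u C h0 hν hu h]
  refine Finset.sum_congr rfl fun i _ => ?_
  have hsi := (hs i).ne'
  field_simp

end LawDec

end Quant

end Summit.CriticalPhenomena.PercolationContinuityZ3.Theorems
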